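/-
Copyright (c) 2026 the pub-hodgecm-mathlib formalisation cell (harness21).  Prover seat hodgecm-mathlib-K2E2-p12 (g9), Track B «K2-LIT», h413 = `stmt-HodgeConjecture-24833`,
R90-TF section S8 «ContSpec-n½», deal S8-R202 (S8 dealer R90-CS-plan (g3)): R7₃ ON-AXIS REAL POLE LEDGER, FILE B — AT THE EXPORTS' LEVEL: the (E6) truncated `L²` family of the
χ-pair Eisenstein series is bounded near every REAL candidate pole `z₀ > 1` at which the continued first scalar is analytic (and real on the real trace) and the diagonal kernel is bounded
— the on-axis (MS-P′) letter of ★ p16 `hbddPK_of_L2Family_letters_cm_three`, hence removability on the real axis for ★ p864043's pole-set shrink (census 886798f0b76d460b).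
-/
import Summits.HodgeConjecture.HodgeConjecture.Theorems.K2E1ChiEisensteinL2BoundRegularPointCMThree   -- ★ FILE A (this seat): `msBound_regular_of_tube_letters_free`; brings the ★ MS chain and ★ p863423
import Summits.HodgeConjecture.HodgeConjecture.Theorems.K2E1SphericalEisensteinL2BoundCMThree        -- ★ (K2E4-p14) `exists_boxes_of_countable` (quarter-plane domains minus a countable closed set: open, preconnected, tube boxes)
import Summits.HodgeConjecture.HodgeConjecture.Theorems.K2E1ConvexDiffCountableConnected             -- ★ `countable_of_codiscrete`
import Mathlib.Analysis.Complex.Convex                                                                 -- Mathlib `convex_halfSpace_re_gt`, `convex_halfSpace_im_gt`, `convex_halfSpace_im_lt`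
import HarnessLib

/-!
# h413 ∕ R90-S8 — `K2E1ChiEisensteinRealAxisPoleLedgerOfExportsCMThree` (R7₃ FILE B): THE (E6) FAMILY IS `L²`-BOUNDED NEAR EVERY REAL CANDIDATE POLE WHERE THE SCALARS ARE REGULAR —
# the on-axis (MS-P′) letter at the exports' level

Cell `pub/hodgecm-mathlib`, crux H413 = `stmt-HodgeConjecture-24833`, route `HCCMUnconditional`; R90-TF section S8, deal S8-R202.  THEOREMS ONLY (no `def`, no `instance`, no notation,
no named-fact hypothesis, no `sorry`; default heartbeats); lane `--supports stmt-HodgeConjecture-24833 --as helper` (count-neutral).  Closes no socket.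

THE MATHEMATICS ([MoeglinWaldspurger1995, IV.1.11, IV.2.3, IV.3.12]; [BernsteinLapid2019, Thm 2.3, §4]).  R7₃ = «on the real segment `(1, 2)` the continued Eisenstein family has poles
only where its constant term (the scalars `qc_j`) has» [MW95 IV.1.11].  ★ FILE A runs the Maass–Selberg chain at a REGULAR real point `z₀ > 1` for an abstract domain package; this file
DISCHARGES the package from the χ-exports (★ p863590 ∕ ★ (C2b) p863930): the candidate pole set `P` is closed and co-discrete, hence countable (★ `countable_of_codiscrete`), so the two
quarter planes `{1 < Re, ±Im > 0} ∖ P` are open and preconnected with tube boxes (★ `exists_boxes_of_countable`: convex open minus countable closed), every non-real point near `z₀` lies in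
them (co-discreteness), the (E6) family `Fam` — holomorphic on `Pᶜ`, `Fam z =ᵐ quotFun (Λ^T (Ec z))` off `P` — is continuous on `V := Pᶜ ∋` a punctured neighbourhood of `z₀`, and agrees
with `[Λ^T E(φ_z)]` on the tube parts by the exports' tube identity `Ec z = E(φ_z)` (`hE2`).  The continued scalars `wc`, `Bc` are taken holomorphic off `P` (they are finite sums over the
continued coordinates `qc_j`, ★ `K2E1ChiScatteringPairingsContinuedCMThree`), with their tube agreements; the REGULAR data at `z₀` is `wc` analytic at `z₀` (⇐ every `qc_j` analytic at `z₀`: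
the scalar half of R7₃), `wc` real on the punctured real trace (reflection letter, as in the ★ middle-pole chain), `Bc z z` bounded near `z₀`.
(ABSTRACT TWIN at the relation-letter level: ★ K2E1-p16 `K2E1ChiEisensteinRealAxisPoleLedgerCMThree.msBound_realPoint_of_letters`, scalar hypotheses `|Im w z| ≤ Cw|Im z|`, `‖w‖, ‖B z z‖`
bounded; this file is the EXPORTS-LEVEL instantiation over ★ FILE A's analytic-scalar form.)
* §1 **`quarterDomains_of_codiscrete`** — the domain package (L1) at the exports' level: `D± := ({1<Re} ∩ {±Im>0}) ∖ P` open, preconnected, inside the quarter planes, with tube boxes,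
  and `∀ᶠ z in 𝓝[≠] z₀, ±Im z > 0 → z ∈ D±` for every real `z₀ > 1`.
* §2 HEAD **`hMSP_onAxis_of_exports_free`** — `∃ C, ∀ᶠ z in 𝓝[≠] z₀, ‖Fam z‖ ≤ C` at a real `z₀ > 1` from the exports' rows + (L2) on `Pᶜ` + (L3′); **`hMSP_onAxis_eLpNorm_of_exports_free`** —
  the same in ★ p16's `eLpNorm` currency (`hMSP` bytes at a real candidate pole).
LETTERS (visible, named): (L2) `wc Bc` holomorphic off `P` with tube agreements (★ p16 part 2a gives them from the continued coordinates); (L3′) `hwa` (⇐ `qc_j` analytic at `z₀` — THE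
scalar half of R7₃: F5's explicit `q = A·L`-ratio, normal form of `qc`, non-vanishing of the partial Hecke `L`-functions on `Re > 1`), `hreal` (reflection principle; derivable by Schwarz
reflection from the tube), `hβB`; the structural frame (normalised `ν`, `μK`, `νI`, `𝓕I`, covering weight) as in ★ §0.
HONEST LABEL: HC_CM is proved only modulo the 7 printed citations (2 remaining named inputs: hLiu418 = `stmt-HodgeConjecture-24832`, h413 = `stmt-HodgeConjecture-24833`) until rung 0
closes; this file asserts no named fact and closes no socket; it does NOT claim that any particular real candidate is removable (that needs (L3′) at the point); count-neutral.

## References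
* [MoeglinWaldspurger1995] C. Mœglin, J.-L. Waldspurger, *Spectral Decomposition and Eisenstein Series* (1995), IV.1.11, IV.2.3, IV.3.12 (a).
* [BernsteinLapid2019] J. Bernstein, E. Lapid, *On the meromorphic continuation of Eisenstein series*, J. AMS 37 (2024), Thm 2.3, §4.
* [Arthur1980TraceFormulaII] J. Arthur, *A trace formula for reductive groups II*, Compositio Math. 40 (1980), §4.
-/

set_option autoImplicit false
set_option linter.dupNamespace false  -- the mandated namespace repeats the summit's segment (`HodgeConjecture.HodgeConjecture`)

noncomputable section

open MeasureTheory Measure NumberField IsDedekindDomain Set Filter Topology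
open scoped ENNReal NNReal ComplexConjugate InnerProductSpace
open Literature.MeasureTheory.Group Literature.NumberTheory Literature.NumberTheory.Automorphic Literature.NumberTheory.Automorphic.UnitaryGroup Literature.NumberTheory.GaloisRepresentations AdelicGroupData
open Literature.NumberTheory.Automorphic.Arthur2013.Leaves.TECR Literature.NumberTheory.Rogawski1990
open Summit.HodgeConjecture.HodgeConjecture.Cruxes.H413.K2E1BorelEisensteinU Summit.HodgeConjecture.HodgeConjecture.Cruxes.H413.K2E1CharacterEisensteinU2Defs
open Summit.HodgeConjecture.HodgeConjecture.Cruxes.H413.K2E1CharacterEisensteinU3PairDefs Summit.HodgeConjecture.HodgeConjecture.Cruxes.H413.K2E1BLBorelSpacesU2Defs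
open Summit.HodgeConjecture.HodgeConjecture.Cruxes.H413.K2E1SphericalEisensteinL2BoundCMThree (exists_boxes_of_countable)
open Summit.HodgeConjecture.HodgeConjecture.Cruxes.H413.K2E1ConvexDiffCountableConnected (countable_of_codiscrete)
open Summit.HodgeConjecture.HodgeConjecture.Cruxes.H413.K2E1ChiEisensteinL2BoundRegularPointCMThree (msBound_regular_of_tube_letters_free)

namespace Summit.HodgeConjecture.HodgeConjecture.Cruxes.H413.K2E1ChiEisensteinRealAxisPoleLedgerOfExportsCMThree

/-! ## §1 The quarter-plane domain package off a closed co-discrete set -/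

/-- **THE QUARTER-PLANE DOMAINS OFF A CLOSED CO-DISCRETE `P`**: `D⁺ := ({1<Re} ∩ {0<Im}) ∖ P` and `D⁻ := ({1<Re} ∩ {Im<0}) ∖ P` are open and preconnected (convex open minus the countable
closed `P`, ★ `exists_boxes_of_countable`), lie in the quarter planes, carry tube boxes `O₁, O₂′` with `2 < Re z′ < Re z` across them, and contain every non-real point of a punctured
neighbourhood of any real `z₀ > 1` (co-discreteness of `P`). [cite: BernsteinLapid2019, §4 p. 10] -/
theorem quarterDomains_of_codiscrete {P : Set ℂ} (hPc : IsClosed P) (hPcd : ∀ z₀ : ℂ, ∀ᶠ s in 𝓝[≠] z₀, s ∉ P) {z₀ : ℝ} (hz₀ : 1 < z₀) :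
    (IsOpen ((({z : ℂ | 1 < z.re} ∩ {z : ℂ | 0 < z.im}) ∩ univ) \ P) ∧ IsPreconnected ((({z : ℂ | 1 < z.re} ∩ {z : ℂ | 0 < z.im}) ∩ univ) \ P) ∧
      (((({z : ℂ | 1 < z.re} ∩ {z : ℂ | 0 < z.im}) ∩ univ) \ P) ⊆ {z : ℂ | 1 < z.re ∧ 0 < z.im}) ∧
      (∃ O₁ O₂' : Set ℂ, IsOpen O₁ ∧ O₁.Nonempty ∧ O₁ ⊆ ((({z : ℂ | 1 < z.re} ∩ {z : ℂ | 0 < z.im}) ∩ univ) \ P) ∧ IsOpen O₂' ∧ O₂'.Nonempty ∧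
        O₂' ⊆ ((({z : ℂ | 1 < z.re} ∩ {z : ℂ | 0 < z.im}) ∩ univ) \ P) ∧ ∀ z ∈ O₁, ∀ z' ∈ O₂', 2 < z'.re ∧ z'.re < z.re) ∧
      (∀ᶠ z : ℂ in 𝓝[≠] (z₀ : ℂ), 0 < z.im → z ∈ ((({z : ℂ | 1 < z.re} ∩ {z : ℂ | 0 < z.im}) ∩ univ) \ P))) ∧
    (IsOpen ((({z : ℂ | 1 < z.re} ∩ {z : ℂ | z.im < 0}) ∩ univ) \ P) ∧ IsPreconnected ((({z : ℂ | 1 < z.re} ∩ {z : ℂ | z.im < 0}) ∩ univ) \ P) ∧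
      (((({z : ℂ | 1 < z.re} ∩ {z : ℂ | z.im < 0}) ∩ univ) \ P) ⊆ {z : ℂ | 1 < z.re ∧ z.im < 0}) ∧
      (∃ Q₁ Q₂' : Set ℂ, IsOpen Q₁ ∧ Q₁.Nonempty ∧ Q₁ ⊆ ((({z : ℂ | 1 < z.re} ∩ {z : ℂ | z.im < 0}) ∩ univ) \ P) ∧ IsOpen Q₂' ∧ Q₂'.Nonempty ∧
        Q₂' ⊆ ((({z : ℂ | 1 < z.re} ∩ {z : ℂ | z.im < 0}) ∩ univ) \ P) ∧ ∀ z ∈ Q₁, ∀ z' ∈ Q₂', 2 < z'.re ∧ z'.re < z.re) ∧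
      (∀ᶠ z : ℂ in 𝓝[≠] (z₀ : ℂ), z.im < 0 → z ∈ ((({z : ℂ | 1 < z.re} ∩ {z : ℂ | z.im < 0}) ∩ univ) \ P))) := by
  have hPco : P.Countable := countable_of_codiscrete hPcd
  have hS : ∀ C : Set ℂ, ((C \ univ) ∪ P).Countable := fun C =>
    hPco.mono fun z hz => hz.elim (fun h => absurd (mem_univ z) h.2) id
  have hre : IsOpen {z : ℂ | 1 < z.re} := isOpen_lt continuous_const Complex.continuous_re
  have himp : IsOpen {z : ℂ | 0 < z.im} := isOpen_lt continuous_const Complex.continuous_im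
  have himn : IsOpen {z : ℂ | z.im < 0} := isOpen_lt Complex.continuous_im continuous_const
  have hz₀' : 1 < ((z₀ : ℂ)).re := by rwa [Complex.ofReal_re]
  have hnear : ∀ᶠ z : ℂ in 𝓝[≠] (z₀ : ℂ), 1 < z.re ∧ z ∉ P := by
    filter_upwards [mem_nhdsWithin_of_mem_nhds (hre.mem_nhds hz₀'), hPcd (z₀ : ℂ)] with z hz hzP
    exact ⟨hz, hzP⟩
  refine ⟨?_, ?_⟩
  · obtain ⟨hDo, hDc, O₁, O₂', hO₁, hO₁ne, hO₁D, hO₂', hO₂'ne, hO₂'D, hsep⟩ := exists_boxes_of_countable (U := univ) (hre.inter himp)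
      ((convex_halfSpace_re_gt (1 : ℝ)).inter (convex_halfSpace_im_gt (0 : ℝ))) isOpen_univ hPc (hS _)
      (w₁ := ⟨4, 1⟩) (w₂ := ⟨3, 1⟩) ⟨by norm_num, by norm_num⟩ ⟨by norm_num, by norm_num⟩ (by norm_num) (by norm_num)
    refine ⟨hDo, hDc, fun z hz => ⟨hz.1.1.1, hz.1.1.2⟩, ⟨O₁, O₂', hO₁, hO₁ne, hO₁D, hO₂', hO₂'ne, hO₂'D, hsep⟩, ?_⟩
    filter_upwards [hnear] with z hz hzim
    exact ⟨⟨⟨hz.1, hzim⟩, mem_univ z⟩, hz.2⟩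
  · obtain ⟨hDo, hDc, Q₁, Q₂', hQ₁, hQ₁ne, hQ₁D, hQ₂', hQ₂'ne, hQ₂'D, hsep⟩ := exists_boxes_of_countable (U := univ) (hre.inter himn)
      ((convex_halfSpace_re_gt (1 : ℝ)).inter (convex_halfSpace_im_lt (0 : ℝ))) isOpen_univ hPc (hS _)
      (w₁ := ⟨4, -1⟩) (w₂ := ⟨3, -1⟩) ⟨by norm_num, by norm_num⟩ ⟨by norm_num, by norm_num⟩ (by norm_num) (by norm_num)
    refine ⟨hDo, hDc, fun z hz => ⟨hz.1.1.1, hz.1.1.2⟩, ⟨Q₁, Q₂', hQ₁, hQ₁ne, hQ₁D, hQ₂', hQ₂'ne, hQ₂'D, hsep⟩, ?_⟩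
    filter_upwards [hnear] with z hz hzim
    exact ⟨⟨⟨hz.1, hzim⟩, mem_univ z⟩, hz.2⟩

/-! ## §2 HEAD: the (E6) family is bounded near a regular real candidate pole -/

section Free
variable (L : Type) [Field L] [NumberField L] [IsCMField L] [MeasurableSpace (quasiSplit (↥(maximalRealSubfield L)) L (IsCMField.complexConj L) 3).Adelic] [BorelSpace (quasiSplit (↥(maximalRealSubfield L)) L (IsCMField.complexConj L) 3).Adelic]
  [MeasurableSpace (AdeleRing (𝓞 L) L)ˣ] [BorelSpace (AdeleRing (𝓞 L) L)ˣ]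

/-- **R7₃ ON THE REAL AXIS, AT THE EXPORTS' LEVEL (HEAD)**: for the χ-pair section `φ` with the normalised structural data (as ★ §0), the exports' continuation `Ec` (tube identity `hE2`)
with closed co-discrete candidate pole set `P` and its (E6) truncated `L²` family `Fam` at level `T ≥ 1` (holomorphic on `Pᶜ`, `Fam z =ᵐ quotFun (Λ^T (Ec z))` off `P`), the continued
scalars `wc`, `Bc` holomorphic off `P` with their tube agreements, and a REAL `z₀ > 1` at which `wc` is analytic and real on the punctured real trace and `Bc z z` is bounded:
`∃ C, ∀ᶠ z in 𝓝[≠] z₀, ‖Fam z‖ ≤ C` — the on-axis (MS-P′) letter (§1 discharges (L1); ★ FILE A does the rest).  If `z₀ ∈ P`, `z₀ ≠ 3∕2`, this is exactly what ★ p16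
`hbddPK_of_L2Family_letters_cm_three` consumes at `z₀`, so `z₀` is removable for ★ p864043's shrink. [cite: MoeglinWaldspurger1995, IV.1.11, IV.2.3, IV.3.12 (a)]
[cite: BernsteinLapid2019, Thm 2.3, §4] -/
theorem hMSP_onAxis_of_exports_free
    (μ : Measure (quasiSplit (↥(maximalRealSubfield L)) L (IsCMField.complexConj L) 3).automorphicQuotient) [(quasiSplit (↥(maximalRealSubfield L)) L (IsCMField.complexConj L) 3).IsAutomorphicMeasure μ]
    (νG : Measure (quasiSplit (↥(maximalRealSubfield L)) L (IsCMField.complexConj L) 3).Adelic) [νG.IsHaarMeasure] [νG.IsInvInvariant]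
    (μK : Measure ((standardMaximalCompactGL 3 L).comap (adelicVal (↥(maximalRealSubfield L)) L (IsCMField.complexConj L) 3 ((StdForm.antidiagonal 3).over L)) : Subgroup (quasiSplit (↥(maximalRealSubfield L)) L (IsCMField.complexConj L) 3).Adelic))
    [μK.IsHaarMeasure]
    (νI : Measure (AdeleRing (𝓞 L) L)ˣ) [νI.IsHaarMeasure]
    {𝓕I : Set (AdeleRing (𝓞 L) L)ˣ} (h𝓕I : IsIdeleClassDomain L 𝓕I)
    (ν : Measure ↥(adelicUnipotent (↥(maximalRealSubfield L)) L (IsCMField.complexConj L) 3)) [ν.IsHaarMeasure] [ν.IsInvInvariant]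
    {𝓕 : Set ↥(adelicUnipotent (↥(maximalRealSubfield L)) L (IsCMField.complexConj L) 3)} (h𝓕N : IsFundamentalDomain ↥(rationalUnipotent (↥(maximalRealSubfield L)) L (IsCMField.complexConj L) 3) 𝓕 ν) (h𝓕1 : ν 𝓕 = 1)
    (h𝓕c : IsCompact (closure 𝓕))
    {β : (quasiSplit (↥(maximalRealSubfield L)) L (IsCMField.complexConj L) 3).Adelic → ℝ≥0∞} (hβ : IsCoveringWeight ((arithmeticBorel (↥(maximalRealSubfield L)) L (IsCMField.complexConj L) 3).map (quasiSplit (↥(maximalRealSubfield L)) L (IsCMField.complexConj L) 3).arithmeticSubgroup.subtype) β)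
    {T : ℝ≥0} (hT : 1 ≤ T)
    {χ₁ : HeckeCharacter L} {χ₂ : ↥(TorusDict.torus (IsCMField.complexConj L)) →ₜ* ℂˣ}
    (hχ₁ : χ₁.IsUnitary) (hρ₁ : ∀ r : ℝ≥0ˣ, χ₁ (posRealIdele L r) = 1) (hχ₂u : ∀ u, ‖((χ₂ u : ℂˣ) : ℂ)‖ = 1) (hχ₂ : TorusDict.IsAutomorphic (IsCMField.complexConj L) χ₂)
    {φ : (quasiSplit (↥(maximalRealSubfield L)) L (IsCMField.complexConj L) 3).Adelic → ℂ} (hφc : Continuous φ) (hφ : IsChiSectionPair χ₁ χ₂ φ) {Cφ : ℝ} (hφC : ∀ x, ‖φ x‖ ≤ Cφ)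
    -- the exports: tube identity, candidate pole set, the (E6) family at level `T`
    (Ec : ℂ → (quasiSplit (↥(maximalRealSubfield L)) L (IsCMField.complexConj L) 3).Adelic → ℂ) (hE2 : ∀ z : ℂ, 2 < z.re → Ec z = eisensteinSeriesU (flatSectionU φ z))
    {P : Set ℂ} (hPc : IsClosed P) (hPcd : ∀ z₀ : ℂ, ∀ᶠ s in 𝓝[≠] z₀, s ∉ P)
    (Fam : ℂ → Lp ℂ 2 μ) (hFd : DifferentiableOn ℂ Fam Pᶜ)
    (hFam : ∀ z : ℂ, z ∉ P → ((Fam z : Lp ℂ 2 μ) : (quasiSplit (↥(maximalRealSubfield L)) L (IsCMField.complexConj L) 3).automorphicQuotient → ℂ) =ᵐ[μ] (quasiSplit (↥(maximalRealSubfield L)) L (IsCMField.complexConj L) 3).quotFun (truncation ν 𝓕 T (Ec z)))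
    -- (L2) the continued scalars, holomorphic off `P`, with their tube agreements
    {wc : ℂ → ℂ} (hwc : DifferentiableOn ℂ wc Pᶜ)
    (hwagree : ∀ s : ℂ, 2 < s.re → wc s = ∫ x in {x : (AdeleRing (𝓞 L) L)ˣ | (IdeleClassGroup.ideleNorm L x : ℝ) ≤ 1} ∩ 𝓕I, ((IdeleClassGroup.ideleNorm L x : ℝ) : ℂ) * (((reflectChar (IsCMField.complexConj L) χ₁ x : ℂˣ) : ℂ) * conj ((χ₁ x : ℂˣ) : ℂ) * (∫ k, (fun g : (quasiSplit (↥(maximalRealSubfield L)) L (IsCMField.complexConj L) 3).Adelic => (∫ v : ↥(adelicUnipotent (↥(maximalRealSubfield L)) L (IsCMField.complexConj L) 3), flatSectionU φ s ((quasiSplit (↥(maximalRealSubfield L)) L (IsCMField.complexConj L) 3).toAdelic (weylLongU ((IsCMField.complexConj L : L ≃ₐ[↥(maximalRealSubfield L)] L) : L →+* L) (rfl : (StdForm.antidiagonal 3).over L = (StdForm.antidiagonal 3).over L)) * ((v : (quasiSplit (↥(maximalRealSubfield L)) L (IsCMField.complexConj L) 3).Adelic) * g)) ∂ν) * ((borelHeight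 g : ℝ) : ℂ) ^ (s - 2)) (k : (quasiSplit (↥(maximalRealSubfield L)) L (IsCMField.complexConj L) 3).Adelic) * conj (φ (k : (quasiSplit (↥(maximalRealSubfield L)) L (IsCMField.complexConj L) 3).Adelic)) ∂μK)) ∂νI)
    {Bc : ℂ → ℂ → ℂ} (hBc1 : ∀ z' : ℂ, DifferentiableOn ℂ (fun z : ℂ => Bc z z') Pᶜ) (hBc2 : ∀ z : ℂ, DifferentiableOn ℂ (fun u : ℂ => Bc z (conj u)) {u : ℂ | conj u ∉ P})
    (hBagree : ∀ s s' : ℂ, 2 < s.re → 2 < s'.re → Bc s s' = (∫ x in {x : (AdeleRing (𝓞 L) L)ˣ | (IdeleClassGroup.ideleNorm L x : ℝ) ≤ 1} ∩ 𝓕I, ((IdeleClassGroup.ideleNorm L x : ℝ) : ℂ) ∂νI) * (∫ k, (fun g : (quasiSplit (↥(maximalRealSubfield L)) L (IsCMField.complexConj L) 3).Adelic => (∫ v : ↥(adelicUnipotent (↥(maximalRealSubfield L)) L (IsCMField.complexConj L) 3), flatSectionU φ s ((quasiSplit (↥(maximalRealSubfield L)) L (IsCMField.complexConj L) 3).toAdelic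 (weylLongU ((IsCMField.complexConj L : L ≃ₐ[↥(maximalRealSubfield L)] L) : L →+* L) (rfl : (StdForm.antidiagonal 3).over L = (StdForm.antidiagonal 3).over L)) * ((v : (quasiSplit (↥(maximalRealSubfield L)) L (IsCMField.complexConj L) 3).Adelic) * g)) ∂ν) * ((borelHeight g : ℝ) : ℂ) ^ (s - 2)) (k : (quasiSplit (↥(maximalRealSubfield L)) L (IsCMField.complexConj L) 3).Adelic) * conj ((fun g : (quasiSplit (↥(maximalRealSubfield L)) L (IsCMField.complexConj L) 3).Adelic => (∫ v : ↥(adelicUnipotent (↥(maximalRealSubfield L)) L (IsCMField.complexConj L) 3), flatSectionU φ s' ((quasiSplit (↥(maximalRealSubfield L)) L (IsCMField.complexConj L) 3).toAdelic (weylLongU ((IsCMField.complexConj L : L ≃ₐ[↥(maximalRealSubfield L)] L) : L →+* L) (rfl : (StdForm.antidiagonal 3).over L = (StdForm.antidiagonal 3).over L)) * ((v : (quasiSplit (↥(maximalRealSubfield L)) L (IsCMField.complexConj L) 3).Adelic) * g)) ∂ν) * ((borelHeight g : ℝ) : ℂ) ^ (s' - 2)) (k : (quasiSplit (↥(maximalRealSubfield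 L)) L (IsCMField.complexConj L) 3).Adelic)) ∂μK))
    -- (L3′) the regular data at a real `z₀ > 1`
    {z₀ : ℝ} (hz₀ : 1 < z₀) (hwa : AnalyticAt ℂ wc (z₀ : ℂ)) (hreal : ∀ᶠ x : ℝ in 𝓝[≠] z₀, (wc (x : ℂ)).im = 0)
    (hβB : ∃ B : ℝ, ∀ᶠ z in 𝓝[≠] (z₀ : ℂ), ‖Bc z z‖ ≤ B) :
    ∃ C : ℝ, ∀ᶠ z in 𝓝[≠] (z₀ : ℂ), ‖Fam z‖ ≤ C := by
  obtain ⟨⟨hD₁, hD₁c, hD₁sub, ⟨O₁, O₂', hO₁, hO₁ne, hO₁D, hO₂', hO₂'ne, hO₂'D, hsep⟩, hD₁ev⟩, ⟨hD₂, hD₂c, hD₂sub, ⟨Q₁, Q₂', hQ₁, hQ₁ne, hQ₁D, hQ₂', hQ₂'ne, hQ₂'D, hsep₂⟩, hD₂ev⟩⟩ :=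
    quarterDomains_of_codiscrete hPc hPcd hz₀
  have hFtube : ∀ D : Set ℂ, D ⊆ Pᶜ → ∀ z ∈ D, 2 < z.re → ((Fam z : Lp ℂ 2 μ) : (quasiSplit (↥(maximalRealSubfield L)) L (IsCMField.complexConj L) 3).automorphicQuotient → ℂ) =ᵐ[μ]
      (quasiSplit (↥(maximalRealSubfield L)) L (IsCMField.complexConj L) 3).quotFun (truncation ν 𝓕 T (eisensteinSeriesU (flatSectionU φ z))) := fun D hD z hz hz2 => by
    rw [← hE2 z hz2]; exact hFam z (hD hz)
  have hD₁P : ((({z : ℂ | 1 < z.re} ∩ {z : ℂ | 0 < z.im}) ∩ univ) \ P) ⊆ Pᶜ := fun z hz => hz.2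
  have hD₂P : ((({z : ℂ | 1 < z.re} ∩ {z : ℂ | z.im < 0}) ∩ univ) \ P) ⊆ Pᶜ := fun z hz => hz.2
  exact msBound_regular_of_tube_letters_free L μ νG μK νI h𝓕I ν h𝓕N h𝓕1 h𝓕c hβ hT hχ₁ hρ₁ hχ₂u hχ₂ hφc hφ hφC hD₁ hD₁c hD₁sub hO₁ hO₁ne hO₁D hO₂' hO₂'ne hO₂'D hsep
    hD₂ hD₂c hD₂sub hQ₁ hQ₁ne hQ₁D hQ₂' hQ₂'ne hQ₂'D hsep₂ hz₀ hD₁ev hD₂ev Fam (hFd.mono hD₁P) (hFd.mono hD₂P) hPc.isOpen_compl (hPcd (z₀ : ℂ)) hFd.continuousOn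
    (hFtube _ hD₁P) (hFtube _ hD₂P) (hwc.mono hD₁P) (hwc.mono hD₂P) hwagree (fun z' _ => (hBc1 z').mono hD₁P) (fun z _ => (hBc2 z).mono fun u hu => hu.2)
    (fun z' _ => (hBc1 z').mono hD₂P) (fun z _ => (hBc2 z).mono fun u hu => hu.2) hBagree hwa hreal hβB

/-- **THE SAME IN ★ p16's `eLpNorm` CURRENCY** (`hMSP` bytes at a real candidate pole, one level `T`): `∃ C, ∀ᶠ z in 𝓝[≠] z₀, (eLpNorm (quotFun (Λ^T (Ec z))) 2 μ).toReal ≤ C` — the bound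
on `‖Fam z‖` read through `eLpNorm_congr_ae` + `Lp.norm_def` (★ p16's dictionary `eLpNorm_toReal_eq_norm_of_ae_eq`) at the points `z ∉ P` of the punctured neighbourhood. [cite: MoeglinWaldspurger1995, IV.3.12 (a)] -/
theorem hMSP_onAxis_eLpNorm_of_exports_free
    (μ : Measure (quasiSplit (↥(maximalRealSubfield L)) L (IsCMField.complexConj L) 3).automorphicQuotient) [(quasiSplit (↥(maximalRealSubfield L)) L (IsCMField.complexConj L) 3).IsAutomorphicMeasure μ]
    (νG : Measure (quasiSplit (↥(maximalRealSubfield L)) L (IsCMField.complexConj L) 3).Adelic) [νG.IsHaarMeasure] [νG.IsInvInvariant]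
    (μK : Measure ((standardMaximalCompactGL 3 L).comap (adelicVal (↥(maximalRealSubfield L)) L (IsCMField.complexConj L) 3 ((StdForm.antidiagonal 3).over L)) : Subgroup (quasiSplit (↥(maximalRealSubfield L)) L (IsCMField.complexConj L) 3).Adelic))
    [μK.IsHaarMeasure]
    (νI : Measure (AdeleRing (𝓞 L) L)ˣ) [νI.IsHaarMeasure]
    {𝓕I : Set (AdeleRing (𝓞 L) L)ˣ} (h𝓕I : IsIdeleClassDomain L 𝓕I)
    (ν : Measure ↥(adelicUnipotent (↥(maximalRealSubfield L)) L (IsCMField.complexConj L) 3)) [ν.IsHaarMeasure] [ν.IsInvInvariant]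
    {𝓕 : Set ↥(adelicUnipotent (↥(maximalRealSubfield L)) L (IsCMField.complexConj L) 3)} (h𝓕N : IsFundamentalDomain ↥(rationalUnipotent (↥(maximalRealSubfield L)) L (IsCMField.complexConj L) 3) 𝓕 ν) (h𝓕1 : ν 𝓕 = 1)
    (h𝓕c : IsCompact (closure 𝓕))
    {β : (quasiSplit (↥(maximalRealSubfield L)) L (IsCMField.complexConj L) 3).Adelic → ℝ≥0∞} (hβ : IsCoveringWeight ((arithmeticBorel (↥(maximalRealSubfield L)) L (IsCMField.complexConj L) 3).map (quasiSplit (↥(maximalRealSubfield L)) L (IsCMField.complexConj L) 3).arithmeticSubgroup.subtype) β)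
    {T : ℝ≥0} (hT : 1 ≤ T)
    {χ₁ : HeckeCharacter L} {χ₂ : ↥(TorusDict.torus (IsCMField.complexConj L)) →ₜ* ℂˣ}
    (hχ₁ : χ₁.IsUnitary) (hρ₁ : ∀ r : ℝ≥0ˣ, χ₁ (posRealIdele L r) = 1) (hχ₂u : ∀ u, ‖((χ₂ u : ℂˣ) : ℂ)‖ = 1) (hχ₂ : TorusDict.IsAutomorphic (IsCMField.complexConj L) χ₂)
    {φ : (quasiSplit (↥(maximalRealSubfield L)) L (IsCMField.complexConj L) 3).Adelic → ℂ} (hφc : Continuous φ) (hφ : IsChiSectionPair χ₁ χ₂ φ) {Cφ : ℝ} (hφC : ∀ x, ‖φ x‖ ≤ Cφ)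
    -- the exports: tube identity, candidate pole set, the (E6) family at level `T`
    (Ec : ℂ → (quasiSplit (↥(maximalRealSubfield L)) L (IsCMField.complexConj L) 3).Adelic → ℂ) (hE2 : ∀ z : ℂ, 2 < z.re → Ec z = eisensteinSeriesU (flatSectionU φ z))
    {P : Set ℂ} (hPc : IsClosed P) (hPcd : ∀ z₀ : ℂ, ∀ᶠ s in 𝓝[≠] z₀, s ∉ P)
    (Fam : ℂ → Lp ℂ 2 μ) (hFd : DifferentiableOn ℂ Fam Pᶜ)
    (hFam : ∀ z : ℂ, z ∉ P → ((Fam z : Lp ℂ 2 μ) : (quasiSplit (↥(maximalRealSubfield L)) L (IsCMField.complexConj L) 3).automorphicQuotient → ℂ) =ᵐ[μ] (quasiSplit (↥(maximalRealSubfield L)) L (IsCMField.complexConj L) 3).quotFun (truncation ν 𝓕 T (Ec z)))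
    -- (L2) the continued scalars, holomorphic off `P`, with their tube agreements
    {wc : ℂ → ℂ} (hwc : DifferentiableOn ℂ wc Pᶜ)
    (hwagree : ∀ s : ℂ, 2 < s.re → wc s = ∫ x in {x : (AdeleRing (𝓞 L) L)ˣ | (IdeleClassGroup.ideleNorm L x : ℝ) ≤ 1} ∩ 𝓕I, ((IdeleClassGroup.ideleNorm L x : ℝ) : ℂ) * (((reflectChar (IsCMField.complexConj L) χ₁ x : ℂˣ) : ℂ) * conj ((χ₁ x : ℂˣ) : ℂ) * (∫ k, (fun g : (quasiSplit (↥(maximalRealSubfield L)) L (IsCMField.complexConj L) 3).Adelic => (∫ v : ↥(adelicUnipotent (↥(maximalRealSubfield L)) L (IsCMField.complexConj L) 3), flatSectionU φ s ((quasiSplit (↥(maximalRealSubfield L)) L (IsCMField.complexConj L) 3).toAdelic (weylLongU ((IsCMField.complexConj L : L ≃ₐ[↥(maximalRealSubfield L)] L) : L →+* L) (rfl : (StdForm.antidiagonal 3).over L = (StdForm.antidiagonal 3).over L)) * ((v : (quasiSplit (↥(maximalRealSubfield L)) L (IsCMField.complexConj L) 3).Adelic) * g)) ∂ν) * ((borelHeight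 g : ℝ) : ℂ) ^ (s - 2)) (k : (quasiSplit (↥(maximalRealSubfield L)) L (IsCMField.complexConj L) 3).Adelic) * conj (φ (k : (quasiSplit (↥(maximalRealSubfield L)) L (IsCMField.complexConj L) 3).Adelic)) ∂μK)) ∂νI)
    {Bc : ℂ → ℂ → ℂ} (hBc1 : ∀ z' : ℂ, DifferentiableOn ℂ (fun z : ℂ => Bc z z') Pᶜ) (hBc2 : ∀ z : ℂ, DifferentiableOn ℂ (fun u : ℂ => Bc z (conj u)) {u : ℂ | conj u ∉ P})
    (hBagree : ∀ s s' : ℂ, 2 < s.re → 2 < s'.re → Bc s s' = (∫ x in {x : (AdeleRing (𝓞 L) L)ˣ | (IdeleClassGroup.ideleNorm L x : ℝ) ≤ 1} ∩ 𝓕I, ((IdeleClassGroup.ideleNorm L x : ℝ) : ℂ) ∂νI) * (∫ k, (fun g : (quasiSplit (↥(maximalRealSubfield L)) L (IsCMField.complexConj L) 3).Adelic => (∫ v : ↥(adelicUnipotent (↥(maximalRealSubfield L)) L (IsCMField.complexConj L) 3), flatSectionU φ s ((quasiSplit (↥(maximalRealSubfield L)) L (IsCMField.complexConj L) 3).toAdelic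 (weylLongU ((IsCMField.complexConj L : L ≃ₐ[↥(maximalRealSubfield L)] L) : L →+* L) (rfl : (StdForm.antidiagonal 3).over L = (StdForm.antidiagonal 3).over L)) * ((v : (quasiSplit (↥(maximalRealSubfield L)) L (IsCMField.complexConj L) 3).Adelic) * g)) ∂ν) * ((borelHeight g : ℝ) : ℂ) ^ (s - 2)) (k : (quasiSplit (↥(maximalRealSubfield L)) L (IsCMField.complexConj L) 3).Adelic) * conj ((fun g : (quasiSplit (↥(maximalRealSubfield L)) L (IsCMField.complexConj L) 3).Adelic => (∫ v : ↥(adelicUnipotent (↥(maximalRealSubfield L)) L (IsCMField.complexConj L) 3), flatSectionU φ s' ((quasiSplit (↥(maximalRealSubfield L)) L (IsCMField.complexConj L) 3).toAdelic (weylLongU ((IsCMField.complexConj L : L ≃ₐ[↥(maximalRealSubfield L)] L) : L →+* L) (rfl : (StdForm.antidiagonal 3).over L = (StdForm.antidiagonal 3).over L)) * ((v : (quasiSplit (↥(maximalRealSubfield L)) L (IsCMField.complexConj L) 3).Adelic) * g)) ∂ν) * ((borelHeight g : ℝ) : ℂ) ^ (s' - 2)) (k : (quasiSplit (↥(maximalRealSubfield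 L)) L (IsCMField.complexConj L) 3).Adelic)) ∂μK))
    -- (L3′) the regular data at a real `z₀ > 1`
    {z₀ : ℝ} (hz₀ : 1 < z₀) (hwa : AnalyticAt ℂ wc (z₀ : ℂ)) (hreal : ∀ᶠ x : ℝ in 𝓝[≠] z₀, (wc (x : ℂ)).im = 0)
    (hβB : ∃ B : ℝ, ∀ᶠ z in 𝓝[≠] (z₀ : ℂ), ‖Bc z z‖ ≤ B) :
    ∃ C : ℝ, ∀ᶠ z in 𝓝[≠] (z₀ : ℂ), (eLpNorm ((quasiSplit (↥(maximalRealSubfield L)) L (IsCMField.complexConj L) 3).quotFun (truncation ν 𝓕 T (Ec z))) 2 μ).toReal ≤ C := by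
  obtain ⟨C, hC⟩ := hMSP_onAxis_of_exports_free L μ νG μK νI h𝓕I ν h𝓕N h𝓕1 h𝓕c hβ hT hχ₁ hρ₁ hχ₂u hχ₂ hφc hφ hφC Ec hE2 hPc hPcd Fam hFd hFam hwc hwagree hBc1 hBc2 hBagree
    hz₀ hwa hreal hβB
  refine ⟨C, ?_⟩
  filter_upwards [hC, hPcd (z₀ : ℂ)] with z hz hzP
  rw [eLpNorm_congr_ae (hFam z hzP).symm, ← Lp.norm_def]
  exact hz

end Free

end Summit.HodgeConjecture.HodgeConjecture.Cruxes.H413.K2E1ChiEisensteinRealAxisPoleLedgerOfExportsCMThree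

end
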